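/-
Copyright (c) 2026 the pub-hodgecm-mathlib formalisation cell (harness21).  Prover seat hodgecm-mathlib-K2E3-p23 (g7), HCML Track B «K2-LIT»,
h413 = `stmt-HodgeConjecture-24833`, line `K2_E3_EllipticInputs`, unit U12 «Characters», PART «SC» (ED. 2) leaf (SC-an)₂
`sig_K2E3SupercuspidalTruncatedCharAnalyticTwo`, road «FC₂» (dealer K2E3-plan (g4) D132 2026-09-04T14:35:06Z «FC₂-8 = THE ASSEMBLY FILE»):
(FC) ON THE MODEL `U(σ, Φ₂)(K)`, HYPOTHESIS-FIRST on the named rank-one letters at `2 × 2`.  2026-09-04.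
-/
import Summits.HodgeConjecture.HodgeConjecture.Theorems.K2E3FinConjRankOne     -- ★ (FC-8) p857324 (K2E3-p23 g4): `decay_const_eq`; brings ★ generic F3a `lintegral_fibre_lt_top_of_boxDecay`, ★ F1 §4 box kit (any `G`), ★ `tsum_lt_top_of_le_pow_of_linear`, ★ `v_le_iff_normAbs_le`, ★ `isOpen_unitaryInt` ∕ `isCompact_unitaryInt_of_forall_v_eq`, ★ `valuedInteger_eq_integer`
import Summits.HodgeConjecture.HodgeConjecture.Theorems.K2E3HC14EllU11Haar     -- ★ (K2E5-p15 g3, road «HC-14-ell» E4): `U(σ, Φ₂)(K)` IS UNIMODULAR — `isMulRightInvariant_of_isHaarMeasure` (NOT restated; dedup K2E3-p26 (g0) D130)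
import HarnessLib

/-!
# h413 ∕ Track B «K2-LIT», unit U12 «Characters», PART «SC» leaf (SC-an)₂, road «FC₂» — FC₂-8 §A: **(FC) ON THE MODEL `U(σ, Φ₂)(K)`** — for every compact
# `C ⊆ U` and every continuous compactly supported `β ≤ M_b < ∞`: `∫_{C ∩ Φ_β} ∫_U β(x g x⁻¹) dμ(x) dμ(g) < ∞`, `Φ_β = {g | ∫_U β(x g x⁻¹) dμ(x) < ∞}` — the
# `Fin 2` twin of ★ (FC-8) `K2E3FinConjRankOne.finConj`, HYPOTHESIS-FIRST on the four `2 × 2` letters (F1₂-COVER, F1₂-UPPER, F2₂, FC-6₂, FC-5c₂)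
# (Harish-Chandra 1970 Part VI Thm 14 ∕ Part VII §2 in the `L²`-form (FC); Rogawski 1990 §1.9–1.10; Bruhat–Tits (4.4.3))

Cell `pub/hodgecm-mathlib`, crux H413 = `stmt-HodgeConjecture-24833`, route of record `HCCMUnconditional`; chair K2-lead (g2), dealer K2E3-plan (g4), architect
K2E3-p25 (g3).  THEOREMS ONLY (no `def`, no `instance`, no `notation`, no named-fact hypothesis, no `sorry`); lane `--supports stmt-HodgeConjecture-24833 --as helper`,
count-neutral.  This is the ASSEMBLY of road «FC₂» (the in-house payment of (SC-an)₂ = Harish-Chandra 1970 Part VII Thm 16 for the supercuspidal representations of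
`U(Φ₂)(L⁺_v)`, `v` non-split): its LETTERS are the by-name targets of the brick payers (K2E3-p26 (g0) D130 F1₂ `K2E3FinConjCartanCoverTwo`, …).

THE ASSEMBLY (= ★ FC-8 token for token with `3 ↦ 2`).  `U = U(σ, Φ₂)(K)` (`K` a non-archimedean local field of characteristic `0` as a `Valued` field with compatible
`ValuativeRel`, `σ` an isometric involution, `ϖ` a uniformiser), `K₀ = U ∩ GL₂(𝒪)` (★ `unitaryInt`, compact open), ray `a = d(ϖ, (σϖ)⁻¹) ∈ U` (binder; ★
`exists_coe_eq_diagonal_uniformizer_two`), `tₙ = (aⁿ)⁻¹`; letter (F1₂-COVER) `U = ⋃ₙ K₀ tₙ K₀`; box `Ω = K₀ (C ∪ tsupport β) K₀` (compact, `K₀`-bi-invariant,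
`⊆ ⋃_{f ∈ F} f K₀`, entries `≤ exp M` — ★ F1 §4, any group); `μ` right invariant (★ `K2E3HC14EllU11Haar.isMulRightInvariant_of_isHaarMeasure`: `U(σ, Φ₂)(K)` is
unimodular).  By ★ F3a `lintegral_fibre_lt_top_of_boxDecay` (ANY locally compact group) it suffices to give `εₙ` with `Σ εₙ < ∞` and `μ(boxₙ ∩ Zc) ≤ μ(boxₙ) εₙ`
(`boxₙ = Ω ∩ {h | tₙ h tₙ⁻¹ ∈ Ω}`, `Zc` = compact centraliser).  For `n ≥ 5M + 3`, `k = ⌊(n − 5M − 2)∕4⌋`: `h ∈ boxₙ` has all entries `≤ exp M` and, by letter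
(F1₂-UPPER) (conjugation by `tₙ` multiplies the ONE upper entry `h₀₁` by `ϖ⁻ⁿ(σϖ)⁻ⁿ`, `|·| = q^{2n}`), `v(h₀₁) ≤ exp(M − 2n)`; letter (F2₂) (the `(0,1)` entry of
`h⋆Φ₂h = Φ₂`: `σ(h₀₀)h₁₁ + σ(h₁₀)h₀₁ = 1`) gives `|h₀₀|, |h₁₁| ≥ q^{−2M} =: ρ`; letter (FC-6₂) (Hensel on the characteristic polynomial + «separated eigenvalues in `K`
⇒ the centraliser contains the non-compact diagonalisable torus») turns a compact centraliser into the near-collision `|h₀₀ − h₁₁| < q^{−k}`; `boxₙ` is measurable and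
invariant under the compact torus `t_{a'} = d(a', σ(a')⁻¹)`, `|a'| = 1` (§2, any group: `t_{a'} ∈ K₀` commutes with `a`); letter (FC-5c₂) (the near-collision average
over `t_{a'}`, which multiplies `h₀₀` by `a'` and `h₁₁` by `σ(a')⁻¹`, i.e. the pair ratio by the NORM `a'σ(a')`) gives `μ(boxₙ ∩ Zc) ≤ C_* (q^{−k}∕ρ)^κ μ(boxₙ)`; for
`n < 5M + 3` take `εₙ = 1`.  The tail `C_* ρ^{−κ} (q^{−κ})^{k(n)}` with `n ≤ 4 k(n) + 5M + 5` sums (★ `tsum_lt_top_of_le_pow_of_linear`, ★ `decay_const_eq`).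
(The letters' constants `3M < n`, `5M + 4k + 2 ≤ d`, `exp(−2M)` are ★ FC-8's VERBATIM — generous at `2 × 2`, where `M < n`, `exp(−M)` would do; chosen so the brick
payers can port the ★ `Fin 3` proofs line by line.)

* §1 `exists_forall_mem_v_apply_le_exp_fin` — the entries of a compact subset of `U(σ, J)(K) ≤ GL_m(K)` are bounded (★ F1 :293 for every `m`).
* §2 (any group) `mul_eq_mul_of_coe_eq_diagonal`, `smul_box_inter_eq_of_commute` — diagonal elements commute; `t • (Ω ∩ {h | c h c⁻¹ ∈ Ω}) = …` for `t ∈ K₀`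
  commuting with `c` (★ `K2E3FinConjBoxTorusInvariant` made generic); `mem_unitaryInt_of_coe_eq_glDiagonal` (unit diagonal entries ⇒ `∈ K₀`, any `m`).
* §3 **`finConj₂`** — THE HEAD: (FC) on `U(σ, Φ₂)(K)` from the letters (F1₂-COVER) `hcov`, (F1₂-UPPER) `hup`, (F2₂) `hdiag`, (FC-6₂) `hcoll`, (FC-5c₂) `hnc`.

HONEST LABEL.  HC_CM is proved only modulo the 7 printed citations (2 remaining named inputs: hLiu418 = `stmt-HodgeConjecture-24832`, h413 = `stmt-HodgeConjecture-24833`)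
until rung 0 closes; count-neutral; (SC-an)₂ is NOT ★ by this file — it needs the five letters ★ BY NAME, (FC)₂ at the place, the elliptic weight (FC-9)₂ and the (M5h)₂
engine (§B, `Theorems/K2E3SupercuspidalTruncatedCharAnalyticTwoOfLetters.lean`).

## References
* [HarishChandra1970] Harish-Chandra (notes by G. van Dijk), *Harmonic Analysis on Reductive p-adic Groups*, LNM 162 (1970), Part V §3, Part VI §8 Theorem 14 p. 60,
  Part VII §2 p. 69, §3 Theorem 16 p. 67.
* [Rogawski1990] J. D. Rogawski, *Automorphic Representations of Unitary Groups in Three Variables*, Ann. of Math. Stud. 123 (1990), §1.9–§1.10 pp. 8–9, §7.3 p. 97.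
* [BruhatTits1972] F. Bruhat, J. Tits, *Groupes réductifs sur un corps local I*, Publ. Math. IHÉS 41 (1972), (4.4.3).
* [Cartier1979] P. Cartier, *Representations of p-adic groups: a survey*, Proc. Sympos. Pure Math. 33.1 (1979), §I.3–I.4.
-/

set_option autoImplicit false
-- the mandated namespace repeats `HodgeConjecture.HodgeConjecture`, as in every `Theorems/*.lean` of this sub-problem
set_option linter.dupNamespace false

noncomputable section

open MeasureTheory MeasureTheory.Measure Set ValuativeRel
open scoped ENNReal NNReal Pointwise MatrixGroups WithZero Valued

namespace Summit.HodgeConjecture.HodgeConjecture.Cruxes.H413.K2E3FinConjAssemblyTwo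

open Literature.NumberTheory.Automorphic Literature.NumberTheory.Automorphic.UnitaryGroup Literature.NumberTheory.Automorphic.HermitianLattice
open Literature.NumberTheory.GaloisRepresentations Literature.NumberTheory.GaloisRepresentations.IsNonarchimedeanLocalField
open Literature.NumberTheory.Automorphic.SymplecticCartan
open K2E3FinConjCartanCover K2E3FinConjOfBoxDecay K2E3GeometricTailSummable K2E3SplitTorusTwistModuleBound

/-! ## §1 Entries of a compact subset of `U(σ, J)(K) ≤ GL_m(K)` are bounded -/

section Entries

variable {K : Type*} [Field K] [Valued K ℤᵐ⁰] (σ : K →+* K) {m : ℕ} (J : Matrix (Fin m) (Fin m) K) {ϖ : K}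

/-- **The entries of a compact subset of `U` are bounded**: `∃ M, ∀ g ∈ Ω, ∀ i j, v(gᵢⱼ) ≤ exp M` (each entry is continuous; ★ `exists_forall_v_le_exp_of_isCompact`; the
maximum over the `m²` entries) — ★ F1 `exists_forall_mem_v_apply_le_exp` for every size `m`. [cite: Tits1979, §3.2] -/
theorem exists_forall_mem_v_apply_le_exp_fin (hϖ : Valued.v ϖ = WithZero.exp (-1 : ℤ)) {Ω : Set ↥(unitaryGroupOfForm σ J)} (hΩ : IsCompact Ω) :
    ∃ M : ℕ, ∀ g ∈ Ω, ∀ i j, Valued.v (((g : GL (Fin m) K) : Matrix (Fin m) (Fin m) K) i j) ≤ WithZero.exp (M : ℤ) := by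
  have hcont : ∀ i j : Fin m, Continuous fun g : ↥(unitaryGroupOfForm σ J) => ((g : GL (Fin m) K) : Matrix (Fin m) (Fin m) K) i j :=
    fun i j => (Units.continuous_val.comp continuous_subtype_val).matrix_elem i j
  choose M hM using fun ij : Fin m × Fin m => exists_forall_v_le_exp_of_isCompact hϖ (hΩ.image (hcont ij.1 ij.2))
  refine ⟨Finset.univ.sup M, fun g hg i j => ?_⟩
  refine (hM (i, j) _ ⟨g, hg, rfl⟩).trans (WithZero.exp_le_exp.2 ?_)
  exact_mod_cast Finset.le_sup (f := M) (Finset.mem_univ (i, j))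

end Entries

/-! ## §2 Diagonal elements commute; the box is torus invariant (any group); unit diagonal elements are in `K₀` -/

section Generic

variable {G : Type*} [Group G] (K₀ : Subgroup G)

/-- `c (t h) c⁻¹ = t (c h c⁻¹)` when `c` and `t` commute. [cite: Rogawski1990, §1.10 p. 9] -/
theorem conj_mul_eq_mul_conj_of_commute {c t : G} (hct : Commute c t) (h : G) : c * (t * h) * c⁻¹ = t * (c * h * c⁻¹) := by
  rw [← mul_assoc c t h, hct.eq, mul_assoc t c h, mul_assoc t (c * h) c⁻¹]

/-- **THE BOX IS TORUS-INVARIANT** (★ `K2E3FinConjBoxTorusInvariant.torusOne_smul_box_eq` made generic): for a subgroup `K₀ ≤ G`, any `S₀ ⊆ G`, any `c ∈ G` and any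
`t ∈ K₀` commuting with `c`: `t • (K₀S₀K₀ ∩ {h | c h c⁻¹ ∈ K₀S₀K₀}) = K₀S₀K₀ ∩ {h | c h c⁻¹ ∈ K₀S₀K₀}` (`K₀S₀K₀` is left-`K₀`-invariant, ★ F1 `mul_mem_box_iff`).
[cite: BruhatTits1972, (4.4.3)] [cite: Rogawski1990, §1.10 p. 9] -/
theorem smul_box_inter_eq_of_commute (S₀ : Set G) (c : G) {t : G} (htK : t ∈ K₀) (hct : Commute c t) :
    t • (((K₀ : Set G) * S₀ * (K₀ : Set G)) ∩ {h : G | c * h * c⁻¹ ∈ (K₀ : Set G) * S₀ * (K₀ : Set G)}) =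
      ((K₀ : Set G) * S₀ * (K₀ : Set G)) ∩ {h : G | c * h * c⁻¹ ∈ (K₀ : Set G) * S₀ * (K₀ : Set G)} := by
  have htiK : t⁻¹ ∈ K₀ := K₀.inv_mem htK
  have hcti : Commute c t⁻¹ := hct.inv_right
  ext x
  rw [mem_smul_set_iff_inv_smul_mem, smul_eq_mul, mem_inter_iff, mem_inter_iff, mem_setOf_eq, mem_setOf_eq,
    mul_mem_box_iff K₀ S₀ htiK x, conj_mul_eq_mul_conj_of_commute hcti x, mul_mem_box_iff K₀ S₀ htiK (c * x * c⁻¹)]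

end Generic

section Diagonal

variable {K : Type*} [Field K] [Valued K ℤᵐ⁰] (σ : K →+* K) {m : ℕ} {J : Matrix (Fin m) (Fin m) K}

omit [Valued K ℤᵐ⁰] in
/-- **Two elements of `U(σ, J)(K)` with diagonal matrices commute** (★ `K2E3FinConjBoxTorusInvariant.mul_eq_mul_of_diagonal`, every size `m`). [cite: Rogawski1990, §1.10 p. 9] -/
theorem commute_of_coe_eq_diagonal (c t : ↥(unitaryGroupOfForm σ J)) {d e : Fin m → K}
    (hc : ((c : GL (Fin m) K) : Matrix (Fin m) (Fin m) K) = Matrix.diagonal d) (ht : ((t : GL (Fin m) K) : Matrix (Fin m) (Fin m) K) = Matrix.diagonal e) :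
    Commute c t := by
  refine Subtype.ext (Units.ext ?_)
  show ((c : GL (Fin m) K) : Matrix (Fin m) (Fin m) K) * ((t : GL (Fin m) K) : Matrix (Fin m) (Fin m) K) =
    ((t : GL (Fin m) K) : Matrix (Fin m) (Fin m) K) * ((c : GL (Fin m) K) : Matrix (Fin m) (Fin m) K)
  rw [hc, ht, Matrix.diagonal_mul_diagonal, Matrix.diagonal_mul_diagonal]
  congr 1
  funext k
  exact mul_comm _ _

/-- **A DIAGONAL UNITARY WITH UNIT ENTRIES IS IN `K₀ = U ∩ GL_m(𝒪)`**: if `t = diag(d)` with `|d_k| = 1` for all `k` then `t` and `t⁻¹ = diag(d⁻¹)` are integral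
(★ `mem_unitaryInt_iff`; ★ `K2E3FinConjBoxTorusInvariant.glDiagonal_mem_unitaryInt` for every size). [cite: BruhatTits1972, (4.4.3)] [cite: Rogawski1990, §1.10 p. 9] -/
theorem mem_unitaryInt_of_coe_eq_glDiagonal {t : ↥(unitaryGroupOfForm σ J)} {d : Fin m → Kˣ} (ht : (t : GL (Fin m) K) = glDiagonal m K d)
    (hd : ∀ k, Valued.v (d k : K) = 1) : t ∈ unitaryInt σ J := by
  rw [mem_unitaryInt_iff]
  refine ⟨fun i j => ?_, fun i j => ?_⟩
  · rw [ht, coe_glDiagonal, Matrix.diagonal_apply]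
    split_ifs
    · exact (hd i).le
    · rw [map_zero]; exact zero_le
  · rw [ht, ← map_inv, coe_glDiagonal, Matrix.diagonal_apply]
    split_ifs
    · rw [Pi.inv_apply, Units.val_inv_eq_inv_val, map_inv₀, hd i, inv_one]
    · rw [map_zero]; exact zero_le

/-- The entries `a', σ(a')⁻¹` of `t_{a'} = d(a', σ(a')⁻¹)` are units for `a' ∈ 𝒪^×` (`σ` isometric). [cite: Rogawski1990, §1.10 p. 9] -/
theorem v_torusPairVec_eq_one (hσv : ∀ x, Valued.v (σ x) = Valued.v x) {a' : Kˣ} (ha' : Valued.v (a' : K) = 1) (k : Fin 2) :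
    Valued.v ((![a', (Units.map (σ : K →* K) a')⁻¹] k : Kˣ) : K) = 1 := by
  have h2 : ∀ k : Fin 2, k = 0 ∨ k = 1 := by decide
  rcases h2 k with rfl | rfl
  · exact ha'
  · show Valued.v (((Units.map (σ : K →* K) a')⁻¹ : Kˣ) : K) = 1
    rw [Units.val_inv_eq_inv_val, Units.coe_map, MonoidHom.coe_coe, map_inv₀, hσv, ha', inv_one]

end Diagonal

/-! ## §3 THE HEAD: (FC) on `U(σ, Φ₂)(K)` from the `2 × 2` letters -/

/-- **(FC)₂ — THE FINITE CONJUGATION MEASURE ON `U(σ, Φ₂)(K)`, FROM THE RANK-ONE LETTERS AT `2 × 2`.**  `K` a non-archimedean local field of characteristic zero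
(`Valued` + compatible `ValuativeRel`), `σ` an isometric involution, `ϖ` a uniformiser, `J = Φ₂`, `μ` ANY Haar measure on `U = U(σ, J)(K)` (second countable, locally
compact), `a ∈ U` with matrix `d(ϖ, (σϖ)⁻¹)` (★ `exists_coe_eq_diagonal_uniformizer_two`).  GIVEN the letters
(F1₂-COVER) `hcov` «`U = ⋃ₙ K₀ (aⁿ)⁻¹ K₀`» [BruhatTits1972 (4.4.3)], (F1₂-UPPER) `hup` «entries of `(aⁿ)⁻¹ h aⁿ` at most `exp M` ⇒ `v(h₀₁) ≤ exp(M − 2n)`»,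
(F2₂) `hdiag` «all entries `≤ exp M`, `v(h₀₁) ≤ exp(M − 2n)`, `3M < n` ⇒ `v(hᵢᵢ) ≥ exp(−2M)`», (FC-6₂) `hcoll` «… and compact centraliser, `5M + 4k + 2 ≤ n` ⇒
`v(hᵢᵢ − hⱼⱼ) < exp(−k)` for some `i ≠ j`» and (FC-5c₂) `hnc` «on a measurable set invariant under every `t = d(a', σ(a')⁻¹)`, `|a'| = 1`, with `|g₀₀|, |g₁₁| ≥ ρ`:
`μ(· ∩ {near-collision ≤ ε}) ≤ C (ε∕ρ)^κ μ(·)`», for every compact `C ⊆ U` and every continuous `β : U → [0, ∞]` with compact topological support and `β ≤ M_b < ∞`: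
`∫⁻_{g ∈ C ∩ {g | ∫⁻ β(x g x⁻¹) dμ(x) < ⊤}} ∫⁻ β(x g x⁻¹) dμ(x) dμ(g) < ⊤` — the `hFC` shape of ★ (FC-9), i.e. road «FC₂»'s replacement of Harish-Chandra's Theorem 14 for
the compact Cartan subgroups of `U(1,1)`.  Proof = ★ FC-8 `finConj` token for token over ★ generic F3a. [cite: HarishChandra1970, Part VI §8 Theorem 14 p. 60; Part VII §2 p. 69]
[cite: Rogawski1990, §7.3 p. 97; §1.10 p. 9] [cite: BruhatTits1972, (4.4.3)] [cite: Cartier1979, §I.3–I.4] -/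
theorem finConj₂ {K : Type*} [Field K] [Valued K ℤᵐ⁰] [ValuativeRel K] [(Valued.v : Valuation K ℤᵐ⁰).Compatible] [IsNonarchimedeanLocalField K]
    (σ : K →+* K) (hσ : ∀ x, σ (σ x) = x) (hσv : ∀ x, Valued.v (σ x) = Valued.v x) {ϖ : K} (hϖ : Valued.v ϖ = WithZero.exp (-1 : ℤ))
    {J : Matrix (Fin 2) (Fin 2) K} (hJ : J = (StdForm.antidiagonal 2).over K)
    [MeasurableSpace ↥(unitaryGroupOfForm σ J)] [BorelSpace ↥(unitaryGroupOfForm σ J)]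
    [SecondCountableTopology ↥(unitaryGroupOfForm σ J)] [LocallyCompactSpace ↥(unitaryGroupOfForm σ J)]
    (μ : Measure ↥(unitaryGroupOfForm σ J)) [μ.IsHaarMeasure]
    (a : ↥(unitaryGroupOfForm σ J)) (ha : ((a : GL (Fin 2) K) : Matrix (Fin 2) (Fin 2) K) = Matrix.diagonal ![ϖ, (σ ϖ)⁻¹])
    (hcov : ∀ g : ↥(unitaryGroupOfForm σ J), ∃ n : ℕ,
      g ∈ (unitaryInt σ J : Set ↥(unitaryGroupOfForm σ J)) * {(a ^ n)⁻¹} * (unitaryInt σ J : Set ↥(unitaryGroupOfForm σ J)))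
    (hup : ∀ (n M : ℕ) (h : ↥(unitaryGroupOfForm σ J)),
      (∀ i j, Valued.v (((((a ^ n)⁻¹ * h * a ^ n : ↥(unitaryGroupOfForm σ J)) : GL (Fin 2) K) : Matrix (Fin 2) (Fin 2) K) i j) ≤ WithZero.exp (M : ℤ)) →
        Valued.v (((h : GL (Fin 2) K) : Matrix (Fin 2) (Fin 2) K) 0 1) ≤ WithZero.exp ((M : ℤ) - 2 * n))
    (hdiag : ∀ (M n : ℕ), 3 * M < n → ∀ h : ↥(unitaryGroupOfForm σ J),
      (∀ i j, Valued.v (((h : GL (Fin 2) K) : Matrix (Fin 2) (Fin 2) K) i j) ≤ WithZero.exp (M : ℤ)) →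
      Valued.v (((h : GL (Fin 2) K) : Matrix (Fin 2) (Fin 2) K) 0 1) ≤ WithZero.exp ((M : ℤ) - 2 * n) →
        ∀ i, WithZero.exp (-(2 * (M : ℤ))) ≤ Valued.v (((h : GL (Fin 2) K) : Matrix (Fin 2) (Fin 2) K) i i))
    (hcoll : ∀ (M k d : ℕ), 5 * M + 4 * k + 2 ≤ d → ∀ g : ↥(unitaryGroupOfForm σ J),
      (∀ i j, Valued.v (((g : GL (Fin 2) K) : Matrix (Fin 2) (Fin 2) K) i j) ≤ WithZero.exp (M : ℤ)) →
      Valued.v (((g : GL (Fin 2) K) : Matrix (Fin 2) (Fin 2) K) 0 1) ≤ WithZero.exp ((M : ℤ) - 2 * d) →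
      IsCompact ((Subgroup.centralizer ({g} : Set ↥(unitaryGroupOfForm σ J))) : Set ↥(unitaryGroupOfForm σ J)) →
        ∃ i j : Fin 2, i ≠ j ∧
          Valued.v (((g : GL (Fin 2) K) : Matrix (Fin 2) (Fin 2) K) i i - ((g : GL (Fin 2) K) : Matrix (Fin 2) (Fin 2) K) j j) < WithZero.exp (-(k : ℤ)))
    (hnc : ∃ κ : ℝ, 0 < κ ∧ ∃ C : ℝ≥0∞, C ≠ ⊤ ∧ ∀ ρ : ℝ≥0, 0 < ρ → ∀ ε : ℝ≥0,
      ∀ B : Set ↥(unitaryGroupOfForm σ J), MeasurableSet B →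
        (∀ t : ↥(unitaryGroupOfForm σ J),
          (∃ a' : Kˣ, valuation K (a' : K) = 1 ∧ (t : GL (Fin 2) K) = glDiagonal 2 K ![a', (Units.map (σ : K →* K) a')⁻¹]) → t • B = B) →
        (∀ g ∈ B, ρ ≤ normAbs K (((g : GL (Fin 2) K) : Matrix (Fin 2) (Fin 2) K) 0 0) ∧ ρ ≤ normAbs K (((g : GL (Fin 2) K) : Matrix (Fin 2) (Fin 2) K) 1 1)) →
        μ (B ∩ {g | ∃ i j : Fin 2, i ≠ j ∧
            normAbs K (((g : GL (Fin 2) K) : Matrix (Fin 2) (Fin 2) K) i i - ((g : GL (Fin 2) K) : Matrix (Fin 2) (Fin 2) K) j j) ≤ ε}) ≤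
          C * ((ε / ρ : ℝ≥0) : ℝ≥0∞) ^ κ * μ B)
    {C : Set ↥(unitaryGroupOfForm σ J)} (hC : IsCompact C) {β : ↥(unitaryGroupOfForm σ J) → ℝ≥0∞} (hβ : Continuous β) (hβs : IsCompact (tsupport β))
    {Mb : ℝ≥0∞} (hMb : Mb ≠ ⊤) (hβM : ∀ g, β g ≤ Mb) :
    ∫⁻ g in C ∩ {g : ↥(unitaryGroupOfForm σ J) | ∫⁻ x, β (x * g * x⁻¹) ∂μ < ⊤}, ∫⁻ x, β (x * g * x⁻¹) ∂μ ∂μ < ⊤ := by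
  -- §0 frame facts
  have hϖ0 : ϖ ≠ 0 := fun h => by rw [h, map_zero] at hϖ; exact WithZero.zero_ne_coe hϖ
  haveI : CompactSpace (Valued.integer K) := by rw [valuedInteger_eq_integer]; infer_instance
  haveI : μ.IsMulRightInvariant := K2E3HC14EllU11Haar.isMulRightInvariant_of_isHaarMeasure σ hσ hσv hJ μ
  -- §1 `K₀`, the cover
  have hKo : IsOpen (unitaryInt σ J : Set ↥(unitaryGroupOfForm σ J)) := isOpen_unitaryInt σ _
  have hKc : IsCompact (unitaryInt σ J : Set ↥(unitaryGroupOfForm σ J)) := isCompact_unitaryInt_of_forall_v_eq hσv _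
  -- §2 the box `Ω = K₀ (C ∪ tsupport β) K₀`
  set S₀ : Set ↥(unitaryGroupOfForm σ J) := C ∪ tsupport β with hS₀
  have hS₀c : IsCompact S₀ := hC.union hβs
  set Ω : Set ↥(unitaryGroupOfForm σ J) :=
    (unitaryInt σ J : Set ↥(unitaryGroupOfForm σ J)) * S₀ * (unitaryInt σ J : Set ↥(unitaryGroupOfForm σ J)) with hΩ
  have hΩc : IsCompact Ω := isCompact_box _ hKc hS₀c
  have hΩm : MeasurableSet Ω := hΩc.isClosed.measurableSet
  have hCΩ : C ⊆ Ω := (Set.subset_union_left).trans (subset_box _ S₀)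
  have hβΩ : ∀ g, β g ≠ 0 → g ∈ Ω := fun g hg => subset_box _ S₀ (Set.subset_union_right (subset_tsupport β hg))
  have hΩl : ∀ k ∈ unitaryInt σ J, ∀ g, k * g ∈ Ω ↔ g ∈ Ω := fun k hk g => mul_mem_box_iff _ S₀ hk g
  have hΩr : ∀ k ∈ unitaryInt σ J, ∀ g, g * k ∈ Ω ↔ g ∈ Ω := fun k hk g => mem_box_mul_iff _ S₀ hk g
  obtain ⟨F, hΩF⟩ := exists_finset_subset_biUnion_smul (unitaryInt σ J) hKo hΩc
  obtain ⟨M, hM⟩ := exists_forall_mem_v_apply_le_exp_fin σ J hϖ hΩc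
  -- §3 the (FC-5c₂) constants
  obtain ⟨κ, hκ, Cst, hCst, h5⟩ := hnc
  -- §4 radii `x = |ϖ|`, `ρ = |ϖ|^{2M}`, ratio `r = |ϖ|^κ`, constant `B`, threshold `n₀`, depth `k(n)` and the decay sequence `ε`
  set x : ℝ≥0 := normAbs K ϖ with hx
  have hx0 : x ≠ 0 := (map_ne_zero (normAbs K)).2 hϖ0
  have hx1 : x < 1 := by
    have hv : Valued.v ϖ < Valued.v (1 : K) := by
      rw [hϖ, map_one, ← WithZero.exp_zero]; exact WithZero.exp_lt_exp.2 (by norm_num)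
    have hle : normAbs K ϖ ≤ normAbs K 1 := (v_le_iff_normAbs_le _ _).1 hv.le
    have hne : normAbs K ϖ ≠ normAbs K 1 := fun h => hv.ne ((v_eq_iff_normAbs_eq _ _).2 h)
    rw [map_one] at hle hne
    exact lt_of_le_of_ne hle hne
  set ρ : ℝ≥0 := normAbs K (ϖ ^ (2 * M)) with hρ
  have hρ0 : ρ ≠ 0 := (map_ne_zero (normAbs K)).2 (pow_ne_zero _ hϖ0)
  have hρpos : 0 < ρ := pos_iff_ne_zero.2 hρ0
  set r : ℝ≥0∞ := ((x : ℝ≥0) : ℝ≥0∞) ^ κ with hr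
  have hr1 : r < 1 := ENNReal.rpow_lt_one (by exact_mod_cast hx1) hκ
  have hr0 : r ≠ 0 := (ENNReal.rpow_pos (by exact_mod_cast pos_iff_ne_zero.2 hx0) ENNReal.coe_ne_top).ne'
  set B : ℝ≥0∞ := Cst * (((ρ⁻¹ : ℝ≥0)) : ℝ≥0∞) ^ κ with hB
  have hBT : B ≠ ⊤ := ENNReal.mul_ne_top hCst (ENNReal.rpow_ne_top_of_nonneg hκ.le ENNReal.coe_ne_top)
  set n₀ : ℕ := 5 * M + 3 with hn₀
  set kf : ℕ → ℕ := fun n => (n - (5 * M + 2)) / 4 with hkf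
  set ε : ℕ → ℝ≥0∞ := fun n => if n < n₀ then 1 else Cst * (((x ^ kf n / ρ : ℝ≥0)) : ℝ≥0∞) ^ κ with hε
  have hεeq : ∀ n, n₀ ≤ n → ε n = B * r ^ kf n := fun n hn => by
    simp only [hε, if_neg (not_lt.2 hn)]
    exact K2E3FinConjRankOne.decay_const_eq Cst x ρ hκ.le (kf n)
  have hεT : ∀ n, ε n ≠ ⊤ := fun n => by
    by_cases hn : n < n₀
    · simp only [hε, if_pos hn]; exact ENNReal.one_ne_top
    · rw [hεeq n (not_lt.1 hn)]; exact ENNReal.mul_ne_top hBT (ENNReal.pow_ne_top (hr1.trans ENNReal.one_lt_top).ne)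
  have hεsum : ∑' n, ε n ≠ ⊤ :=
    (tsum_lt_top_of_le_pow_of_linear hεT hBT hr0 hr1 (n₀ := n₀) (c := 5 * M + 5) (k := kf)
      (fun n hn => by simp only [hkf, hn₀] at hn ⊢; omega) (fun n hn => (hεeq n hn).le)).ne
  -- §5 the decay on each box
  have hvρ : Valued.v (ϖ ^ (2 * M)) = WithZero.exp (-(2 * (M : ℤ))) := by
    rw [map_pow, hϖ, ← WithZero.exp_nsmul, nsmul_eq_mul]; push_cast; ring_nf
  have hdecay : ∀ n, μ (Ω ∩ {h : ↥(unitaryGroupOfForm σ J) | (a ^ n)⁻¹ * h * ((a ^ n)⁻¹)⁻¹ ∈ Ω} ∩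
      {h : ↥(unitaryGroupOfForm σ J) | IsCompact ((Subgroup.centralizer ({h} : Set ↥(unitaryGroupOfForm σ J))) : Set ↥(unitaryGroupOfForm σ J))}) ≤
      μ (Ω ∩ {h : ↥(unitaryGroupOfForm σ J) | (a ^ n)⁻¹ * h * ((a ^ n)⁻¹)⁻¹ ∈ Ω}) * ε n := by
    intro n
    by_cases hn : n < n₀
    · simp only [hε, if_pos hn, mul_one]; exact measure_mono Set.inter_subset_left
    rw [not_lt] at hn
    simp only [hε, if_neg (not_lt.2 hn)]
    set box : Set ↥(unitaryGroupOfForm σ J) := Ω ∩ {h : ↥(unitaryGroupOfForm σ J) | (a ^ n)⁻¹ * h * ((a ^ n)⁻¹)⁻¹ ∈ Ω} with hbox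
    have hk : 5 * M + 4 * kf n + 2 ≤ n := by simp only [hkf, hn₀] at hn ⊢; omega
    have hn3 : 3 * M < n := by simp only [hn₀] at hn; omega
    -- entries on the box: all `≤ exp M`, the upper one small (letter F1₂-UPPER)
    have hfacts : ∀ h ∈ box, (∀ i j, Valued.v (((h : GL (Fin 2) K) : Matrix (Fin 2) (Fin 2) K) i j) ≤ WithZero.exp (M : ℤ)) ∧
        Valued.v (((h : GL (Fin 2) K) : Matrix (Fin 2) (Fin 2) K) 0 1) ≤ WithZero.exp ((M : ℤ) - 2 * n) := by
      intro h hh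
      have hconj : (a ^ n)⁻¹ * h * a ^ n ∈ Ω := by
        have h' := hh.2
        rwa [Set.mem_setOf_eq, inv_inv] at h'
      exact ⟨hM h hh.1, hup n M h (fun i j => hM _ hconj i j)⟩
    -- the box is measurable and torus invariant; the diagonal is bounded below by `ρ` on it (letter F2₂)
    have hboxm : MeasurableSet box :=
      hΩm.inter (hΩc.isClosed.preimage ((continuous_const.mul continuous_id).mul continuous_const)).measurableSet
    have htorus : ∀ t : ↥(unitaryGroupOfForm σ J),
        (∃ a' : Kˣ, valuation K (a' : K) = 1 ∧ (t : GL (Fin 2) K) = glDiagonal 2 K ![a', (Units.map (σ : K →* K) a')⁻¹]) → t • box = box := by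
      rintro t ⟨a', ha', ht⟩
      have htK : t ∈ unitaryInt σ J :=
        mem_unitaryInt_of_coe_eq_glDiagonal σ ht (v_torusPairVec_eq_one σ hσv ((v_eq_one_iff_valuation_eq_one _).2 ha'))
      have htd : ((t : GL (Fin 2) K) : Matrix (Fin 2) (Fin 2) K) = Matrix.diagonal fun k => ((![a', (Units.map (σ : K →* K) a')⁻¹] k : Kˣ) : K) := by
        rw [ht]; exact coe_glDiagonal 2 K _
      have hat : Commute a t := commute_of_coe_eq_diagonal σ a t ha htd
      have hct : Commute (a ^ n)⁻¹ t := (hat.pow_left n).inv_left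
      exact smul_box_inter_eq_of_commute (unitaryInt σ J) S₀ ((a ^ n)⁻¹) htK hct
    have hlow : ∀ g ∈ box, ρ ≤ normAbs K (((g : GL (Fin 2) K) : Matrix (Fin 2) (Fin 2) K) 0 0) ∧ ρ ≤ normAbs K (((g : GL (Fin 2) K) : Matrix (Fin 2) (Fin 2) K) 1 1) := by
      intro g hg
      obtain ⟨hall, h01⟩ := hfacts g hg
      have key : ∀ i, ρ ≤ normAbs K (((g : GL (Fin 2) K) : Matrix (Fin 2) (Fin 2) K) i i) := fun i => by
        have hi := hdiag M n hn3 g hall h01 i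
        rw [← hvρ] at hi
        exact (v_le_iff_normAbs_le _ _).1 hi
      exact ⟨key 0, key 1⟩
    -- letter (FC-6₂): compact centraliser in the box ⇒ near diagonal collision at scale `|ϖ|^k`
    have hvk : Valued.v (ϖ ^ kf n) = WithZero.exp (-(kf n : ℤ)) := by
      rw [map_pow, hϖ, ← WithZero.exp_nsmul, nsmul_eq_mul, mul_neg_one]
    have hsub : box ∩ {h : ↥(unitaryGroupOfForm σ J) |
        IsCompact ((Subgroup.centralizer ({h} : Set ↥(unitaryGroupOfForm σ J))) : Set ↥(unitaryGroupOfForm σ J))} ⊆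
        box ∩ {g : ↥(unitaryGroupOfForm σ J) | ∃ i j : Fin 2, i ≠ j ∧
          normAbs K (((g : GL (Fin 2) K) : Matrix (Fin 2) (Fin 2) K) i i - ((g : GL (Fin 2) K) : Matrix (Fin 2) (Fin 2) K) j j) ≤ x ^ kf n} := by
      rintro h ⟨hh, hZ⟩
      refine ⟨hh, ?_⟩
      obtain ⟨hall, h01⟩ := hfacts h hh
      obtain ⟨i, j, hij, hv⟩ := hcoll M (kf n) n hk h hall h01 hZ
      refine ⟨i, j, hij, ?_⟩
      have hle : Valued.v (((h : GL (Fin 2) K) : Matrix (Fin 2) (Fin 2) K) i i - ((h : GL (Fin 2) K) : Matrix (Fin 2) (Fin 2) K) j j) ≤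
          Valued.v (ϖ ^ kf n) := by rw [hvk]; exact hv.le
      have hn' := (v_le_iff_normAbs_le _ _).1 hle
      rwa [map_pow] at hn'
    calc μ (box ∩ {h : ↥(unitaryGroupOfForm σ J) |
            IsCompact ((Subgroup.centralizer ({h} : Set ↥(unitaryGroupOfForm σ J))) : Set ↥(unitaryGroupOfForm σ J))})
        ≤ μ (box ∩ {g : ↥(unitaryGroupOfForm σ J) | ∃ i j : Fin 2, i ≠ j ∧
            normAbs K (((g : GL (Fin 2) K) : Matrix (Fin 2) (Fin 2) K) i i - ((g : GL (Fin 2) K) : Matrix (Fin 2) (Fin 2) K) j j) ≤ x ^ kf n}) :=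
          measure_mono hsub
      _ ≤ Cst * (((x ^ kf n / ρ : ℝ≥0)) : ℝ≥0∞) ^ κ * μ box := h5 ρ hρpos (x ^ kf n) box hboxm htorus hlow
      _ = μ box * (Cst * (((x ^ kf n / ρ : ℝ≥0)) : ℝ≥0∞) ^ κ) := by rw [mul_comm]
  -- §6 the generic assembly ★ F3a
  exact lintegral_fibre_lt_top_of_boxDecay μ (unitaryInt σ J) hKo hKc (fun n => (a ^ n)⁻¹) hcov Ω hΩl hΩr F hΩF hCΩ hβ hβΩ hMb hβM ε hεsum hdecay

end Summit.HodgeConjecture.HodgeConjecture.Cruxes.H413.K2E3FinConjAssemblyTwo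

end
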